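import Summits.BirchSwinnertonDyer.BirchSwinnertonDyer.Theorems.UniversalToricDescentThinCombDescentNoPseudoNullOfFacts
import Summits.BirchSwinnertonDyer.BirchSwinnertonDyer.Theorems.EisensteinPrimesSurLambdaCaseCTCOfPoitouTateAt
import Literature.NumberTheory.IwasawaTheory.Greenberg2016.SelmerAlmostDivisibleCaseCOfHTwoVanishing
import Literature.NumberTheory.GaloisCohomology.TateGlobalEulerCharacteristicTotallyComplex
import HarnessLib

/-!
# Line `thin_comb` on the WALL `AdditiveSplitIMCInclusionAtThree` (stmt-BirchSwinnertonDyer-20395): the support stub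
# `stub_noPseudoNull` CLOSED MODULO ONE TEXTBOOK FACT — the natural Ш-restricted Poitou–Tate duality at finite `S` of
# totally complex fields (Milne ADT I Thm. 4.10 (a)) — in place of Greenberg 2016 Prop. 4.1.1 BY NAME
# (helper, `--supports stmt-BirchSwinnertonDyer-20395`; cell `pub/bsd-wall`, lead `cruxlead-20395` g7)

Up to this file `stub_noPseudoNull` (line `thin_comb` v3–v8) was closed modulo the NAMED fact
`Greenberg2016.prop411_selmer_isAlmostDivisible` (`…ClosedModuloV6.stub_noPseudoNull_of_prop411`, p707629), itself reduced by seat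
`bsd-input-gr16-prop411` to three NAMED [Gr4] facts (Greenberg 2006 Props. 5.2, 6.3, Thm. 1 (i)) plus [Gr5] Prop. 3.2.1 (c) at its
printed generality (`h321`). Two observations remove all four at the wall's instance (`𝐃 = Ind_{K̃_∞/K}(E_K[p^∞])` over
`Λ₂ = ℤ_p⟦T₁,T₂⟧`, `K` imaginary quadratic, `2 < p = v v̄`, `X_Gr₂` torsion):
1. **`H²(K_Σ/K, 𝐃) = 0`**: the squeeze (`…GreenbergRoadOfTateTC.leo_and_crk_fullAt_of_squeeze_ofTateTC`) gives
   `corank_{Λ₂} H² = 0`, cofinite generation (Prop. 3.2 from Tate (TC), tree theorem) makes it cotorsion, and `cd_p ≤ 2` (Harari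
   17.13 (a), PROVED at totally complex fields) makes it divisible — hence zero; then Greenberg 2006 Prop. 6.10 runs with `Σ' = ∅`,
   giving (α) and «`Ш²(K, Σ, 𝐃[π]) = 0` a.a. `Π`» WITHOUT Props. 5.2 / 6.3 / Thm. 1 (i)
   (`Literature/…/Greenberg2016/{GlobalH1AlmostDivisible,SelmerAlmostDivisibleCaseC}OfHTwoVanishing.lean`, p727850 / p728036).
2. **`h321` at a totally complex `K` is the END statement of the cell `bsd-eis` road «SUR-Λ»** (`SurLambda.sur_of_crk_caseC_tc_of_dualSha_torsion`
   + `Greenberg2016.dualSha_torsion_of_poitouTateAt`) modulo the single textbook fact `GaloisCohomology.poitouTate_shaRestricted_tateDual_natural_at K S`.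

§1 `prop321_caseC_of_poitouTateAt`; §2 `fullAtSelmer_isAlmostDivisible_of_prop321_of_isCotorsion_H_two` (generic arena); §3 the curve
instance (twins of `…GreenbergRoadOfTateTC` §2 with `h411` ↦ `hX : ∀ L [IsTotallyComplex L] S, S.Finite → …natural_at L S` — the
conjunct cell `bsd-eis` carries by name in halves v32, target of its lane «PT-Ш-S-TC»; LOC⁽²⁾ and the free Tate-dual basis are no
longer consumed); §4 `xGr₂_hasNoPseudoNullSubmodule_of_poitouTateAt` and **`stub_noPseudoNull_of_poitouTateAt`** — the registered
signature VERBATIM, granted ONLY `hX`.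

HONEST FRAMING: CONDITIONAL on the ONE textbook named statement `hX`; Greenberg 2016 Props. 4.1.1 / 4.2.2, Greenberg 2006 Props. 3.2 /
4.1 / 4.2 / §5 A, Greenberg 2010 Prop. 3.2.1 (c), Milne I 5.1 and Harari 17.13 (a) enter as TREE THEOREMS. Closes nothing by itself;
no summit statement / BSD / the crux is proved here; the research stubs `stub_toricExists`, `stub_combDivisibility` are untouched.
Refs: [Greenberg2016Selmer] 4.1.1 (c), 2.6.3 (c); [Greenberg2006] 6.1, 6.10; [Greenberg2010] 3.2.1 (c); [MilneADT2006] I 4.10 (a), I 5.1.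
-/

set_option linter.dupNamespace false
set_option autoImplicit false
noncomputable section

open scoped Classical
open NumberField IsDedekindDomain Field
open Literature.NumberTheory.EllipticCurves Literature.NumberTheory.GaloisRepresentations
  Literature.NumberTheory.GaloisCohomology
  Literature.NumberTheory.EllipticCurves.Rubin1991
  Literature.NumberTheory.IwasawaTheory Literature.NumberTheory.IwasawaTheory.Greenberg2006
  Literature.NumberTheory.IwasawaTheory.Greenberg2016
  Summit.BirchSwinnertonDyer.BirchSwinnertonDyer.Theorems.GreenbergFullAtSelmer
  Summit.BirchSwinnertonDyer.BirchSwinnertonDyer.Theorems.AcTwistDeformation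
  Summit.BirchSwinnertonDyer.BirchSwinnertonDyer.Theorems.TwistDeformationCofree
  Summit.BirchSwinnertonDyer.BirchSwinnertonDyer.Theorems.SignedBaseChangeAcDivFiniteExponent
  Summit.BirchSwinnertonDyer.BirchSwinnertonDyer.Theorems.SignedBaseChangeAcDivGreenbergSqueeze
  Summit.BirchSwinnertonDyer.BirchSwinnertonDyer.Theorems.SignedBaseChangeAcDivCurveModel
  Summit.BirchSwinnertonDyer.BirchSwinnertonDyer.Theorems.SignedBaseChangeAcDivAssembly
  Summit.BirchSwinnertonDyer.BirchSwinnertonDyer.Theorems.SignedBaseChangeAcDivFiniteExponentTelescope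
  Summit.BirchSwinnertonDyer.BirchSwinnertonDyer.Theorems.SignedBaseChangeAcDivCofree
  Summit.BirchSwinnertonDyer.BirchSwinnertonDyer.Theorems.SignedBaseChangeAcDivTwistLOC1
  Summit.BirchSwinnertonDyer.BirchSwinnertonDyer.Theorems.SignedBaseChangeAcDivGreenbergRoadOfTateTC

namespace Summit.BirchSwinnertonDyer.BirchSwinnertonDyer.Theorems.UniversalToricDescentThinComb.NoPseudoNullOfPoitouTate

/-! ## §1 [Gr5] Prop. 3.2.1 (c) (`h321`) at a totally complex `K`, from the Ш-duality at `S` (road «SUR-Λ» of `bsd-eis`) -/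

section Prop321

variable {p : ℕ} [Fact p.Prime] {K : Type} [Field K] [NumberField K] {S : Set (HeightOneSpectrum (𝓞 K))}

/-- **[Gr5] Prop. 3.2.1 (c) — the inline hypothesis `h321` of `Greenberg2016.SelmerAlmostDivisibleCaseCOfFacts` — at a TOTALLY
COMPLEX `K` and a finite `S ⊇ {v ∣ p}`, GRANTED ONLY `poitouTate_shaRestricted_tateDual_natural_at K S`**: for every
`Λ' ≅ ℤ_p⟦T₁,…,T_{m'}⟧`, every discrete cofinitely generated `Λ'`-divisible `𝐃'` with LEO and every specification with CRK and the
case-(c) data, `φ_𝓛` is surjective. This is the END statement of road «SUR-Λ» in its ARENA-FREE form: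
`SurLambda.sur_of_crk_caseC_tc_of_dualSha_torsion` (Greenberg 2010 Prop. 3.2.1 (c) modulo «`Ш¹(K, Σ, T*)` torsion») fed
`Greenberg2016.dualSha_torsion_of_poitouTateAt` at the canonical local invariant maps.
[cite: Greenberg2010, Prop. 3.2.1 (c) and proof (p. 15 L19–32)] [cite: Greenberg2016Selmer, Prop. 2.6.3 (c) (§2.6 p. 10 L13–22)]
[cite: MilneADT2006, Ch. I, Thm. 4.10 (a) p. 57] -/
theorem prop321_caseC_of_poitouTateAt [IsTotallyComplex K] (hS : S.Finite)
    (hSp : ∀ v : HeightOneSpectrum (𝓞 K), ((p : ℕ) : 𝓞 K) ∈ v.asIdeal → v ∈ S)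
    (hX : poitouTate_shaRestricted_tateDual_natural_at K S) :
    ∀ (P : Type) [CommRing P] [IsLocalRing P] [TopologicalSpace P] [IsTopologicalRing P]
        (m' : ℕ), Nonempty (P ≃+* MvPowerSeries (Fin m') ℤ_[p]) →
      ∀ (D' : Type) [AddCommGroup D'] [Module P D'] [TopologicalSpace D'] [DiscreteTopology D']
        [ContinuousSMul P D'] (ρ' : ContinuousRep (GaloisGroupUnramifiedOutside K S) P D'),
        IsCofinitelyGenerated P D' → (∀ d : D', ∃ n : ℕ, (p ^ n : ℤ) • d = 0) →
      ∀ (L' : Specification S ρ'), IsDivisible P D' → LEO S ρ' → L'.CRK →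
        (∃ η ∈ S, LOC1 S ρ' (Sum.inr η) ∧ IsDivisible P (L'.Q (Sum.inr η))) → L'.SUR := by
  intro P _ _ _ _ m' hP D' _ _ _ _ _ ρ' hD' _ L' hdiv hLEO hCRK hc
  obtain ⟨e'⟩ := hP
  obtain ⟨η, hη, hLOC1, hQ⟩ := hc
  haveI : Finite (SigmaPlace S) := (finite_setOf_inSigma S hS).to_subtype
  haveI : CompactSpace (absoluteGaloisGroup K) := absoluteGaloisGroup_compactSpace _
  exact SurLambda.sur_of_crk_caseC_tc_of_dualSha_torsion ρ' hS hSp e' hD' L' hdiv hCRK hη hLOC1 hQ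
    (dualSha_torsion_of_poitouTateAt ρ' e' hD' hX
      (fun k => LocalInvariants.canonical K (p ^ k))
      (fun v => SurLambda.invLevelLaw_canonical (K := K) (p := p) v)
      (fun k => SchneiderFreeAdditiveX3.PoitouTateReduction.unramifiedOrthogonal_of_isPerfect_allLevels _
        LocalInvariants.canonical_isPerfect)
      hSp hLEO)

end Prop321

/-! ## §2 Prop. 4.1.1 (c) for `𝓛_η` in the generic arena, from `h321`, at a totally complex `K` with `H²(K_Σ/K, 𝐃)` cotorsion -/

section Generic

variable {p : ℕ} [Fact p.Prime] {K : Type} [Field K] [NumberField K]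
  {S : Set (HeightOneSpectrum (𝓞 K))}
  {Λ : Type} [CommRing Λ] [IsLocalRing Λ] [TopologicalSpace Λ] [IsTopologicalRing Λ] {m : ℕ}
  {R : Type} [CommRing R] [IsLocalRing R] [IsNoetherianRing R] [Algebra Λ R]
  {D : Type} [AddCommGroup D] [Module R D] [Module Λ D] [IsScalarTower Λ R D]
  [SMulCommClass R Λ D] [TopologicalSpace D] [DiscreteTopology D] [ContinuousSMul Λ D]
  {ρ : ContinuousRep (GaloisGroupUnramifiedOutside K S) Λ D}

/-- **Greenberg 2016 Prop. 4.1.1 (c) APPLIED to `𝓛_η = (⊤ at η, 0 elsewhere)` — twin of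
`GreenbergFullAtSelmer.fullAtSelmer_isAlmostDivisible_of_facts` with Prop. 4.1.1 BY NAME replaced by [Gr5] Prop. 3.2.1 (c) at its
printed generality (`h321`)**, at a totally complex `K` with `H²(K_Σ/K, 𝐃)` cotorsion: granted `h321`, Prop. 4.2.2 and [Gr4] §5 A
(both tree theorems, kept as binders for drop-in use), the standing data of the arena, RFX, CRK(`𝐃`, `𝓛_η`) and one finite `η ∈ Σ`
with LOC_η⁽¹⁾, the Selmer group `S_{𝓛_η}(K, 𝐃)` is almost divisible. LEO and LOC⁽²⁾ are no longer hypotheses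
(`Greenberg2016.selmer_isAlmostDivisible_caseC_of_prop321_of_isCotorsion_H_two'`).
[cite: Greenberg2016Selmer, Prop. 4.1.1 (c) (§4.1 p. 15 L21–32); Prop. 4.2.2 (§4.2 p. 20 L4–8)] [cite: Greenberg2006, §5 A (p. 373); Prop. 6.10 (p. 385)]
[cite: Greenberg2010, Prop. 3.2.1 (c) (p. 15)] -/
theorem fullAtSelmer_isAlmostDivisible_of_prop321_of_isCotorsion_H_two [IsTotallyComplex K]
    (h321 : ∀ (P : Type) [CommRing P] [IsLocalRing P] [TopologicalSpace P] [IsTopologicalRing P]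
        (m' : ℕ), Nonempty (P ≃+* MvPowerSeries (Fin m') ℤ_[p]) →
      ∀ (D' : Type) [AddCommGroup D'] [Module P D'] [TopologicalSpace D'] [DiscreteTopology D']
        [ContinuousSMul P D'] (ρ' : ContinuousRep (GaloisGroupUnramifiedOutside K S) P D'),
        IsCofinitelyGenerated P D' → (∀ d : D', ∃ n : ℕ, (p ^ n : ℤ) • d = 0) →
      ∀ (L' : Specification S ρ'), IsDivisible P D' → LEO S ρ' → L'.CRK →
        (∃ η ∈ S, LOC1 S ρ' (Sum.inr η) ∧ IsDivisible P (L'.Q (Sum.inr η))) → L'.SUR)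
    (h422 : prop422_localCohomology_isAlmostDivisible)
    (h5A : sec5A_localH2_subsingleton_of_LOC1) (hS : S.Finite)
    (hSp : ∀ v : HeightOneSpectrum (𝓞 K), ((p : ℕ) : 𝓞 K) ∈ v.asIdeal → v ∈ S)
    (hΛ : Nonempty (Λ ≃+* MvPowerSeries (Fin m) ℤ_[p]))
    (hinj : Function.Injective (algebraMap Λ R)) (hfin : Module.Finite Λ R)
    (hcpl : IsAdicComplete (IsLocalRing.maximalIdeal R) R) (hres : Finite (IsLocalRing.ResidueField R))
    (hchar : CharP (IsLocalRing.ResidueField R) p)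
    (hlin : ∀ (g : GaloisGroupUnramifiedOutside K S) (r : R) (d : D), ρ g (r • d) = r • ρ g d)
    (hT : IsCofree R D) (hcf : IsCofinitelyGenerated Λ D) (hpD : ∀ d : D, ∃ n : ℕ, (p ^ n : ℤ) • d = 0)
    (hRFX : RFX Λ D) (hH2 : IsCotorsion Λ (ρ.H 2))
    {η : HeightOneSpectrum (𝓞 K)} (hη : η ∈ S) (hLOC1 : LOC1 S ρ (Sum.inr η))
    (hCRK : (fullAtSpecification S ρ (Sum.inr η)).CRK) :
    IsAlmostDivisible Λ (fullAtSpecification S ρ (Sum.inr η)).selmer :=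
  selmer_isAlmostDivisible_caseC_of_prop321_of_isCotorsion_H_two' S ρ h321 hS hSp hΛ hfin hT hpD
    (fullAtSpecification S ρ (Sum.inr η)) hRFX hH2 hη hLOC1
    (fullAtSpecification_isAlmostDivisible_of_facts h422 h5A hS hSp hΛ hinj hfin hcpl hres hchar hlin
      hT hcf hpD hRFX hη hLOC1)
    hCRK (fullAtSpecification_Q_isCoreflexive (Sum.inr η))

end Generic

/-! ## §3 The curve instance `𝐃 = Ind_{K̃_∞/K}(E_K[p^∞])` (twins of `…GreenbergRoadOfTateTC` §2 with `h411` ↦ `hX`) -/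

section Assembly

variable {K : Type} [Field K] [NumberField K] {S : Set (HeightOneSpectrum (𝓞 K))} {p : ℕ}
  [Fact p.Prime] (W : WeierstrassCurve K)
  [TopologicalSpace (PowerSeries ℤ_[p])] [TopologicalSpace (PowerSeries (PowerSeries ℤ_[p]))]
  [IsTopologicalRing (PowerSeries (PowerSeries ℤ_[p]))]
  [IsTopologicalAddGroup (IndModule₂ ℤ_[p] p (PrimaryTorsion W.geomPoints p))]
  [ContinuousSMul (PowerSeries (PowerSeries ℤ_[p])) (IndModule₂ ℤ_[p] p (PrimaryTorsion W.geomPoints p))]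
  (hS : ∀ v : HeightOneSpectrum (𝓞 K), ((p : ℕ) : 𝓞 K) ∈ v.asIdeal → v ∈ S)
  (κ₁ κ₂ : ZpExtension K p)
  (ρ₀ : ContinuousRep (GaloisGroupUnramifiedOutside K S) ℤ_[p] (PrimaryTorsion W.geomPoints p))
  (vbar : HeightOneSpectrum (𝓞 K)) (γ₁ γ₂ : absoluteGaloisGroup K)
  [hγ : Fact (ZpExtension.IsTopGeneratorPair κ₁ κ₂ γ₁ γ₂)]

/-- **Twin of `SignedBaseChangeAcDivGreenbergRoadOfTateTC.fullAtSelmer_isAlmostDivisible_curve_ofTateTC` with Greenberg 2016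
Prop. 4.1.1 BY NAME replaced by the natural restricted Poitou–Tate Ш-duality at finite `S` of totally complex fields (`hX`).**
At `𝐃 = Ind_{K̃_∞/K}(E_K[p^∞])` over an imaginary quadratic `K`, `2 < p = v v̄`: `S_{𝓛_v}(K, 𝐃)` is almost divisible, granted
Greenberg 2016 Prop. 4.2.2, Greenberg 2006 §5 A / Props. 4.1 / 4.2 by name (all tree theorems), Tate's formula at totally complex
fields by name (tree theorem), `hX`, the line's `Λ₂`-torsion of `X_Gr₂`, (R1a) `E[p^∞]` cofree and (R1b) LOC⁽¹⁾ / `corank H⁰ = 0`.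
The squeeze gives `corank H² = 0`, read as `H²` COTORSION (Prop. 3.2 in degree `2` from Tate), whence `H² = 0` and Prop. 6.10
with `Σ' = ∅` (`fullAtSelmer_isAlmostDivisible_of_prop321_of_isCotorsion_H_two`); `h321` := `prop321_caseC_of_poitouTateAt`.
[cite: Greenberg2016Selmer, Prop. 4.1.1 (c) (§4.1 p. 15 L21–32), §4.3 p. 20 L19–30] [cite: Greenberg2006, Props. 4.1, 4.2, §5 A; Thm. 3 p. 342]
[cite: Greenberg2010, Prop. 3.2.1 (c), Lemma 5.2.2] [cite: MilneADT2006, I Thm. 4.10 (a) (p. 57), I Thm. 5.1 (p. 67)] -/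
theorem fullAtSelmer_isAlmostDivisible_curve_ofPoitouTateAt
    (hX : ∀ (L : Type) [Field L] [NumberField L] [IsTotallyComplex L] (S : Set (HeightOneSpectrum (𝓞 L))),
      S.Finite → poitouTate_shaRestricted_tateDual_natural_at L S)
    (h422 : prop422_localCohomology_isAlmostDivisible)
    (h5A : sec5A_localH2_subsingleton_of_LOC1) (h41 : prop41_globalEulerPoincareCorank)
    (h42 : prop42_localEulerPoincareCorank)
    (hT : ∀ (L : Type) [Field L] [NumberField L] [IsTotallyComplex L], tateGlobalEulerPoincareCharacteristic L)
    (hSf : S.Finite) (hp : 2 < p) (hK : IsImaginaryQuadratic K)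
    {v : HeightOneSpectrum (𝓞 K)} (hv : ((p : ℕ) : 𝓞 K) ∈ v.asIdeal)
    (hvbar : ((p : ℕ) : 𝓞 K) ∈ vbar.asIdeal) (hne : vbar ≠ v)
    (hNS : ∀ n ∈ ramificationSubgroup K S, ∀ P : PrimaryTorsion W.geomPoints p, n • P = P)
    (hρ₀ : ∀ (σ : absoluteGaloisGroup K) (P : PrimaryTorsion W.geomPoints p),
      ρ₀ (toUnramifiedQuot K S σ) P = σ • P)
    (htors : Module.IsTorsion (IwasawaAlgebra₂ p) (W.XGr₂ p κ₁ κ₂ vbar γ₁ γ₂))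
    (hcofree : IsCofree ℤ_[p] (PrimaryTorsion W.geomPoints p))
    (hLOC1 : ∀ w : HeightOneSpectrum (𝓞 K), w ∈ S → LOC1 S (twistDeformation S hS κ₁ κ₂ ρ₀) (Sum.inr w))
    (h0loc : ∀ w : HeightOneSpectrum (𝓞 K), w ∈ S →
      HasCorank (IwasawaAlgebra₂ p) ((localRep S (twistDeformation S hS κ₁ κ₂ ρ₀) (Sum.inr w)).H 0) 0)
    (h0 : HasCorank (IwasawaAlgebra₂ p) ((twistDeformation S hS κ₁ κ₂ ρ₀).H 0) 0) :
    IsAlmostDivisible (IwasawaAlgebra₂ p)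
      (fullAtSpecification S (twistDeformation S hS κ₁ κ₂ ρ₀) (Sum.inr v)).selmer := by
  set ρ := twistDeformation S hS κ₁ κ₂ ρ₀ with hρ
  -- standing clauses of the arena at `Λ = R = Λ₂`
  have hΛ := nonempty_iwasawaAlgebraTwoVar_ringEquiv_mvPowerSeries p
  have hcpl := isAdicComplete_maximalIdeal_iwasawaAlgebraTwoVar p
  have hres := finite_residueField_iwasawaAlgebraTwoVar p
  have hchar := charP_residueField_iwasawaAlgebraTwoVar p
  have hinj : Function.Injective
      (algebraMap (PowerSeries (PowerSeries ℤ_[p])) (PowerSeries (PowerSeries ℤ_[p]))) :=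
    fun a b h ↦ by simpa using h
  have hfin : Module.Finite (PowerSeries (PowerSeries ℤ_[p])) (PowerSeries (PowerSeries ℤ_[p])) :=
    inferInstance
  have hlin : ∀ (g : GaloisGroupUnramifiedOutside K S) (r : PowerSeries (PowerSeries ℤ_[p]))
      (d : IndModule₂ ℤ_[p] p (PrimaryTorsion W.geomPoints p)), ρ g (r • d) = r • ρ g d :=
    fun g r d ↦ twistDeformation_smul S hS κ₁ κ₂ ρ₀ g r d
  -- `𝐃`: cofree, cofinitely generated, `p`-primary, RFX, corank `m`
  have hA : ∀ a : PrimaryTorsion W.geomPoints p, ∃ k : ℕ, p ^ k • a = 0 := fun a ↦ by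
    obtain ⟨k, hk⟩ := a.exists_pow_smul_eq_zero
    exact ⟨k, PrimaryTorsion.ext (by rw [PrimaryTorsion.val_nsmul]; exact hk)⟩
  have hTc : IsCofree (PowerSeries (PowerSeries ℤ_[p])) (IndModule₂ ℤ_[p] p (PrimaryTorsion W.geomPoints p)) :=
    IndModule₂.isCofree hA hcofree
  have hcf := IsCofree.isCofinitelyGenerated hTc
  have hRFX : RFX (PowerSeries (PowerSeries ℤ_[p])) (IndModule₂ ℤ_[p] p (PrimaryTorsion W.geomPoints p)) :=
    IndModule₂.rfx hA hcofree
  have hm := IndModule₂.hasCorank (p := p) hA hcofree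
  have hpD : ∀ d : IndModule₂ ℤ_[p] p (PrimaryTorsion W.geomPoints p), ∃ n : ℕ, (p ^ n : ℤ) • d = 0 :=
    IndModule₂.exists_pow_smul_eq_zero
  -- `K` is totally complex
  haveI := hK.2
  have hKc : ∀ w : InfinitePlace K, w.IsComplex := IsTotallyComplex.isComplex
  -- `corank S_{𝓛_v} = 0` from the line's torsion input through the bridge
  have hSel : HasCorank (IwasawaAlgebra₂ p) (fullAtSpecification S ρ (Sum.inr v)).selmer 0 := by
    obtain ⟨e, he⟩ := exists_addEquiv_unrSelmer₂_balanced_curve W hS κ₁ κ₂ ρ₀ vbar γ₁ γ₂ hp hK hv hvbar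
      hne hNS hρ₀
    exact hasCorank_zero_of_xGr₂_isTorsion W p κ₁ κ₂ vbar γ₁ γ₂ htors e he
  -- CRK and `corank H² = 0` by the squeeze (η = v, η' = v̄ of local degree one; `r₂ = 1`), Prop. 3.2 read from Tate (TC)
  have hr₂ := nrComplexPlaces_eq_one_of_isImaginaryQuadratic hK
  have hdeg : vbar.asIdeal.ramificationIdx ℤ * vbar.asIdeal.inertiaDeg ℤ = 1 :=
    (ncard_primesOver_eq_two_and_deg_one_of_ne hK.1 hv hvbar hne).2 hvbar
  have hSp : ∀ w : HeightOneSpectrum (𝓞 K), w ∈ S → ((p : ℕ) : 𝓞 K) ∈ w.asIdeal → w = v ∨ w = vbar :=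
    fun w _ hw ↦ eq_or_eq_of_natCast_mem_of_ne hK.1 hv hvbar hne hw
  obtain ⟨-, hCRK, -, hH2⟩ := leo_and_crk_fullAt_of_squeeze_ofTateTC ρ h41 h42 hT h5A hSf hS hKc hr₂ hΛ hpD
    hcf hm h0 (hS vbar hvbar) hne hvbar hdeg hSp hLOC1 h0loc hSel
  -- `H²(K_Σ/K, 𝐃)` is cotorsion: corank `0` and cofinitely generated (Prop. 3.2 in degree `2` from Tate (TC))
  haveI : IsDomain (PowerSeries (PowerSeries ℤ_[p])) := inferInstance
  have hH2cot : IsCotorsion (IwasawaAlgebra₂ p) (ρ.H 2) :=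
    isCotorsion_of_isCofinitelyGenerated_of_hasCorank_zero
      (prop32_global_le_two_of_tate_tc hT hSf hS hΛ ρ hpD hcf 2) hH2
  -- Prop. 4.1.1 (c) from `h321` = road «SUR-Λ» fed `hX K S`
  exact fullAtSelmer_isAlmostDivisible_of_prop321_of_isCotorsion_H_two
    (prop321_caseC_of_poitouTateAt hSf hS (hX K S hSf)) h422 h5A hSf hS hΛ hinj hfin hcpl hres hchar
    hlin hTc hcf hpD hRFX hH2cot (hS v hv) (hLOC1 v (hS v hv)) hCRK

/-- **Twin of `…GreenbergRoadOfTateTC.exists_almostDivisible_bridge_curve_ofTateTC` with `h411` ↦ `hX`** (the bridge hypothesis).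
[cite: Greenberg2016Selmer, Prop. 4.1.1 p. 15] [cite: Greenberg2006, Thm. 3 p. 342] [cite: MilneADT2006, I Thm. 4.10 (a) (p. 57)] -/
theorem exists_almostDivisible_bridge_curve_ofPoitouTateAt
    (hX : ∀ (L : Type) [Field L] [NumberField L] [IsTotallyComplex L] (S : Set (HeightOneSpectrum (𝓞 L))),
      S.Finite → poitouTate_shaRestricted_tateDual_natural_at L S)
    (h422 : prop422_localCohomology_isAlmostDivisible)
    (h5A : sec5A_localH2_subsingleton_of_LOC1) (h41 : prop41_globalEulerPoincareCorank)
    (h42 : prop42_localEulerPoincareCorank)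
    (hT : ∀ (L : Type) [Field L] [NumberField L] [IsTotallyComplex L], tateGlobalEulerPoincareCharacteristic L)
    (hSf : S.Finite) (hp : 2 < p) (hK : IsImaginaryQuadratic K)
    {v : HeightOneSpectrum (𝓞 K)} (hv : ((p : ℕ) : 𝓞 K) ∈ v.asIdeal)
    (hvbar : ((p : ℕ) : 𝓞 K) ∈ vbar.asIdeal) (hne : vbar ≠ v)
    (hNS : ∀ n ∈ ramificationSubgroup K S, ∀ P : PrimaryTorsion W.geomPoints p, n • P = P)
    (hρ₀ : ∀ (σ : absoluteGaloisGroup K) (P : PrimaryTorsion W.geomPoints p),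
      ρ₀ (toUnramifiedQuot K S σ) P = σ • P)
    (htors : Module.IsTorsion (IwasawaAlgebra₂ p) (W.XGr₂ p κ₁ κ₂ vbar γ₁ γ₂))
    (hcofree : IsCofree ℤ_[p] (PrimaryTorsion W.geomPoints p))
    (hLOC1 : ∀ w : HeightOneSpectrum (𝓞 K), w ∈ S → LOC1 S (twistDeformation S hS κ₁ κ₂ ρ₀) (Sum.inr w))
    (h0loc : ∀ w : HeightOneSpectrum (𝓞 K), w ∈ S →
      HasCorank (IwasawaAlgebra₂ p) ((localRep S (twistDeformation S hS κ₁ κ₂ ρ₀) (Sum.inr w)).H 0) 0)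
    (h0 : HasCorank (IwasawaAlgebra₂ p) ((twistDeformation S hS κ₁ κ₂ ρ₀).H 0) 0) :
    ∃ (Sgr : Type) (_ : AddCommGroup Sgr) (_ : Module (IwasawaAlgebra₂ p) Sgr)
      (e : Sgr ≃+ unrSelmer₂ κ₁ κ₂ (W.geomPrimaryTorsion p) vbar),
      IsAlmostDivisible (IwasawaAlgebra₂ p) Sgr ∧
        ∀ (r : IwasawaAlgebra₂ p) (x : W.XGr₂ p κ₁ κ₂ vbar γ₁ γ₂) (c : Sgr), (r • x) (e c) = x (e (r • c)) := by
  obtain ⟨e, he⟩ := exists_addEquiv_unrSelmer₂_balanced_curve W hS κ₁ κ₂ ρ₀ vbar γ₁ γ₂ hp hK hv hvbar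
    hne hNS hρ₀
  exact ⟨_, inferInstance, inferInstance, e,
    fullAtSelmer_isAlmostDivisible_curve_ofPoitouTateAt W hS κ₁ κ₂ ρ₀ vbar γ₁ γ₂ hX h422 h5A h41 h42 hT hSf hp
      hK hv hvbar hne hNS hρ₀ htors hcofree hLOC1 h0loc h0, he⟩

/-- **Twin of `…GreenbergRoadOfTateTC.xGr₂_hasNoPseudoNullSubmodule_curve_ofTateTC` with `h411` ↦ `hX`**: `X_Gr(E/K̃_∞)` has no
non-zero pseudo-null `Λ₂`-submodule. [cite: Greenberg2016Selmer, §1 p. 2, Prop. 4.1.1 p. 15] [cite: MilneADT2006, I Thm. 4.10 (a) (p. 57)] -/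
theorem xGr₂_hasNoPseudoNullSubmodule_curve_ofPoitouTateAt
    (hX : ∀ (L : Type) [Field L] [NumberField L] [IsTotallyComplex L] (S : Set (HeightOneSpectrum (𝓞 L))),
      S.Finite → poitouTate_shaRestricted_tateDual_natural_at L S)
    (h422 : prop422_localCohomology_isAlmostDivisible)
    (h5A : sec5A_localH2_subsingleton_of_LOC1) (h41 : prop41_globalEulerPoincareCorank)
    (h42 : prop42_localEulerPoincareCorank)
    (hT : ∀ (L : Type) [Field L] [NumberField L] [IsTotallyComplex L], tateGlobalEulerPoincareCharacteristic L)
    (hSf : S.Finite) (hp : 2 < p) (hK : IsImaginaryQuadratic K)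
    {v : HeightOneSpectrum (𝓞 K)} (hv : ((p : ℕ) : 𝓞 K) ∈ v.asIdeal)
    (hvbar : ((p : ℕ) : 𝓞 K) ∈ vbar.asIdeal) (hne : vbar ≠ v)
    (hNS : ∀ n ∈ ramificationSubgroup K S, ∀ P : PrimaryTorsion W.geomPoints p, n • P = P)
    (hρ₀ : ∀ (σ : absoluteGaloisGroup K) (P : PrimaryTorsion W.geomPoints p),
      ρ₀ (toUnramifiedQuot K S σ) P = σ • P)
    (htors : Module.IsTorsion (IwasawaAlgebra₂ p) (W.XGr₂ p κ₁ κ₂ vbar γ₁ γ₂))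
    (hcofree : IsCofree ℤ_[p] (PrimaryTorsion W.geomPoints p))
    (hLOC1 : ∀ w : HeightOneSpectrum (𝓞 K), w ∈ S → LOC1 S (twistDeformation S hS κ₁ κ₂ ρ₀) (Sum.inr w))
    (h0loc : ∀ w : HeightOneSpectrum (𝓞 K), w ∈ S →
      HasCorank (IwasawaAlgebra₂ p) ((localRep S (twistDeformation S hS κ₁ κ₂ ρ₀) (Sum.inr w)).H 0) 0)
    (h0 : HasCorank (IwasawaAlgebra₂ p) ((twistDeformation S hS κ₁ κ₂ ρ₀).H 0) 0) :
    HasNoPseudoNullSubmodule (IwasawaAlgebra₂ p) (W.XGr₂ p κ₁ κ₂ vbar γ₁ γ₂) := by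
  obtain ⟨Sgr, _, _, e, hAD, he⟩ := exists_almostDivisible_bridge_curve_ofPoitouTateAt W hS κ₁ κ₂ ρ₀ vbar γ₁ γ₂
    hX h422 h5A h41 h42 hT hSf hp hK hv hvbar hne hNS hρ₀ htors hcofree hLOC1 h0loc h0
  exact xGr₂_hasNoPseudoNullSubmodule_of_isAlmostDivisible W p κ₁ κ₂ vbar γ₁ γ₂ hAD e he

end Assembly

/-! ## §4 Canonical `S`, descended `ρ₀`, bricks plugged: `X_Gr₂` has no pseudo-null submodule / the stub, granted ONLY `hX` -/

/-- **`X_Gr(E/K̃_∞)` has no non-zero pseudo-null `Λ₂`-submodule, GRANTED ONLY the natural restricted Poitou–Tate Ш-duality at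
finite `S` of totally complex fields** (`W/K` elliptic, `K` imaginary quadratic, `2 < p = v v̄` split, ANY generator pair, `X_Gr₂`
torsion) — twin of `DescentNoPseudoNullOfFacts.xGr₂_hasNoPseudoNullSubmodule_of_prop411_of_tateTC`: auxiliary set
`S = {w ∣ p} ∪ {bad w}`, Néron–Ogg–Shafarevich descent `ρ₀`, (R1b) `loc1_and_hasCorank_H0_zero_curve`, (R1a) `isCofree_primaryTorsion`,
and the tree THEOREMS `prop422_…_holds`, `sec5A_…_holds`, `prop42_…_holds`, Prop. 4.1 from Tate (TC) + Harari 17.13 (a) (TC),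
Tate (TC) itself (`forall_tateGlobalEulerPoincareCharacteristic_of_isTotallyComplex`).
[cite: Greenberg2016Selmer, Prop. 4.1.1 (c) (§4.1 p. 15), §4.3 pp. 20–21] [cite: Greenberg2006, Props. 4.1, 4.2, §5 A]
[cite: Greenberg2010, Lemma 5.2.2] [cite: MilneADT2006, I Thm. 4.10 (a) (p. 57), I Thm. 5.1 (p. 67)] [cite: Harari2020, Thm. 17.13 (a)] -/
theorem xGr₂_hasNoPseudoNullSubmodule_of_poitouTateAt {K : Type} [Field K] [NumberField K] {p : ℕ} [Fact p.Prime]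
    (W : WeierstrassCurve K) [W.IsElliptic] (κ₁ κ₂ : ZpExtension K p) (vbar : HeightOneSpectrum (𝓞 K))
    (γ₁ γ₂ : absoluteGaloisGroup K) [hγ : Fact (ZpExtension.IsTopGeneratorPair κ₁ κ₂ γ₁ γ₂)]
    (hX : ∀ (L : Type) [Field L] [NumberField L] [IsTotallyComplex L] (S : Set (HeightOneSpectrum (𝓞 L))),
      S.Finite → poitouTate_shaRestricted_tateDual_natural_at L S)
    (hp : 2 < p) (hK : IsImaginaryQuadratic K)
    {v : HeightOneSpectrum (𝓞 K)} (hv : ((p : ℕ) : 𝓞 K) ∈ v.asIdeal)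
    (hvbar : ((p : ℕ) : 𝓞 K) ∈ vbar.asIdeal) (hne : vbar ≠ v)
    (htors : Module.IsTorsion (IwasawaAlgebra₂ p) (W.XGr₂ p κ₁ κ₂ vbar γ₁ γ₂)) :
    HasNoPseudoNullSubmodule (IwasawaAlgebra₂ p) (W.XGr₂ p κ₁ κ₂ vbar γ₁ γ₂) := by
  -- the discrete topological instances of the road's model
  letI tΛ₁ : TopologicalSpace (PowerSeries ℤ_[p]) := ⊥
  letI tΛ₂ : TopologicalSpace (PowerSeries (PowerSeries ℤ_[p])) := ⊥
  haveI : DiscreteTopology (PowerSeries (PowerSeries ℤ_[p])) := ⟨rfl⟩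
  haveI : IsTopologicalRing (PowerSeries (PowerSeries ℤ_[p])) := inferInstance
  haveI : IsTopologicalAddGroup (IndModule₂ ℤ_[p] p (PrimaryTorsion W.geomPoints p)) := inferInstance
  haveI : ContinuousSMul (PowerSeries (PowerSeries ℤ_[p])) (IndModule₂ ℤ_[p] p (PrimaryTorsion W.geomPoints p)) :=
    inferInstance
  -- the auxiliary set `S = {w ∣ p} ∪ {bad w}`
  set S : Set (HeightOneSpectrum (𝓞 K)) :=
    {w : HeightOneSpectrum (𝓞 K) | ((p : ℕ) : 𝓞 K) ∈ w.asIdeal ∨ ¬ W.HasGoodReductionAt w} with hSdef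
  have hS : ∀ w : HeightOneSpectrum (𝓞 K), ((p : ℕ) : 𝓞 K) ∈ w.asIdeal → w ∈ S :=
    mem_badOrP_of_natCast_mem W p
  have hSbad : ∀ w : HeightOneSpectrum (𝓞 K), ¬ W.HasGoodReductionAt w → w ∈ S := fun w hw ↦ Or.inr hw
  have hSf : S.Finite := by
    refine ((IsDedekindDomain.HeightOneSpectrum.finite_setOf_natCast_mem (R := 𝓞 K)
      (Fact.out : p.Prime).ne_zero).union (W.finite_badPlaces_holds (𝓞 K))).subset ?_
    rintro w (hw | hw)
    · exact Or.inl hw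
    · exact Or.inr hw
  -- Néron–Ogg–Shafarevich and the descended `ρ₀`
  have hNS : ∀ n ∈ ramificationSubgroup K S, ∀ P : PrimaryTorsion W.geomPoints p, n • P = P :=
    fun n hn P ↦ smul_primaryTorsion_eq_of_mem_ramificationSubgroup W p S hSbad hS hn P
  obtain ⟨ρ₀, hρ₀⟩ := exists_continuousRep_primaryTorsion W p S hNS
  -- (R1b): LOC⁽¹⁾ and `corank H⁰ = 0` for the twist deformation, any generator pair, any `ρ₀`
  obtain ⟨hLOC1, h0loc, h00⟩ := loc1_and_hasCorank_H0_zero_curve W κ₁ κ₂ hK hγ.out S hS ρ₀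
  -- the re-plumbed road, with (R1a) and the proved Greenberg facts, Prop. 4.1 from Tate (TC) + Harari 17.13 (a) (TC)
  exact xGr₂_hasNoPseudoNullSubmodule_curve_ofPoitouTateAt W hS κ₁ κ₂ ρ₀ vbar γ₁ γ₂ hX
    prop422_localCohomology_isAlmostDivisible_holds sec5A_localH2_subsingleton_of_LOC1_holds
    (prop41_of_tate_of_poitouTate_three_le_of_isTotallyComplex forall_tateGlobalEulerPoincareCharacteristic_of_isTotallyComplex
      forall_poitouTate_restricted_three_le_of_isTotallyComplex)
    prop42_localEulerPoincareCorank_holds forall_tateGlobalEulerPoincareCharacteristic_of_isTotallyComplex hSf hp hK hv hvbar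
    hne hNS hρ₀ htors (isCofree_primaryTorsion W p) (fun w _ ↦ hLOC1 w) (fun w _ ↦ h0loc w) h00

/-- **`stub_noPseudoNull` of line `thin_comb` (the registered signature VERBATIM), GRANTED ONLY the natural restricted Poitou–Tate
Ш-duality at finite `S` of totally complex fields** — Milne ADT I Thm. 4.10 (a) in the pointwise natural form
`GaloisCohomology.poitouTate_shaRestricted_tateDual_natural_at`, the conjunct the cell `bsd-eis` carries by name in halves v32 and
the target of its background lane «PT-Ш-S-TC». At `p = 3 = 𝔭𝔭′` split in the imaginary quadratic `K`, in any generator pair,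
`X_{∅ at 𝔭, nr at 𝔭′}(E/K̃_∞)` torsion ⟹ every pseudo-null `Λ₂`-submodule is finite (indeed `⊥`:
`xGr₂_hasNoPseudoNullSubmodule_of_poitouTateAt` + `PrintCf2.TwoVarSpecializationFinite.pseudoNull_finite_of_noPseudoNull`).
Greenberg 2016 Prop. 4.1.1 is NO LONGER an input. The frame hypotheses of the stub are not used.
[cite: Greenberg2016Selmer, Prop. 4.1.1 (c) (§4.1 p. 15)] [cite: MilneADT2006, I Thm. 4.10 (a) (p. 57)] -/
theorem stub_noPseudoNull_of_poitouTateAt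
    (hX : ∀ (L : Type) [Field L] [NumberField L] [IsTotallyComplex L] (S : Set (HeightOneSpectrum (𝓞 L))),
      S.Finite → poitouTate_shaRestricted_tateDual_natural_at L S) :
    ∀ (W : WeierstrassCurve ℚ) [W.IsElliptic] [W.IsGloballyMinimal] (K : Type) [Field K] [NumberField K],
    Summit.BirchSwinnertonDyer.Rank1Residual.Additive.ClassO6 W 3 → W.HasSurjectiveModNGaloisRep 3 →
    IsImaginaryQuadratic K →
    ∀ (κ : ZpExtension K 3), κ.IsAnticyclotomic → ∀ (γ : Field.absoluteGaloisGroup K) [Fact (κ.IsTopGenerator γ)]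
      (𝔭 : HeightOneSpectrum (𝓞 K)), ((3 : ℕ) : 𝓞 K) ∈ 𝔭.asIdeal →
    ∀ (𝔭' : HeightOneSpectrum (𝓞 K)), ((3 : ℕ) : 𝓞 K) ∈ 𝔭'.asIdeal → 𝔭' ≠ 𝔭 →
    ∀ (κ₁ κ₂ : ZpExtension K 3) (γ₁ γ₂ : Field.absoluteGaloisGroup K) (k : ℕ)
      [Fact (ZpExtension.IsTopGeneratorPair κ₁ κ₂ γ₁ γ₂)],
    (∀ v : HeightOneSpectrum (𝓞 K), v ≠ 𝔭 → ∀ 𝔓 ∈ v.primesAbove,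
        𝔓.inertia (Field.absoluteGaloisGroup K) ≤ κ₁.kerSubgroup) →
    ZpExtension.pairKer κ₁ κ₂ ≤ κ.kerSubgroup → γ₁ * γ⁻¹ ∈ κ.kerSubgroup → γ₂ * (γ ^ (3 ^ k))⁻¹ ∈ κ.kerSubgroup →
    Module.Finite (IwasawaAlgebra₂ 3) ((W.baseChange K).XGr₂ 3 κ₁ κ₂ 𝔭' γ₁ γ₂) →
    Module.IsTorsion (IwasawaAlgebra₂ 3) ((W.baseChange K).XGr₂ 3 κ₁ κ₂ 𝔭' γ₁ γ₂) →
    ∀ N : Submodule (IwasawaAlgebra₂ 3) ((W.baseChange K).XGr₂ 3 κ₁ κ₂ 𝔭' γ₁ γ₂),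
      Literature.NumberTheory.EllipticCurves.Module.IsPseudoNull (IwasawaAlgebra₂ 3) N → Finite N := by
  intro W _ _ K _ _ _hO6 _hsurj hK κ _hκ γ _ 𝔭 h3 𝔭' h3' hne κ₁ κ₂ γ₁ γ₂ _k _ _hur₁ _hker _hγ₁ _hγ₂ hfin htors
  haveI : (W.baseChange K).IsElliptic := by rw [WeierstrassCurve.baseChange]; infer_instance
  haveI := hfin
  have hPN := xGr₂_hasNoPseudoNullSubmodule_of_poitouTateAt (W.baseChange K) κ₁ κ₂ 𝔭' γ₁ γ₂ hX
    (by norm_num) hK h3 h3' hne htors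
  exact Summit.BirchSwinnertonDyer.BirchSwinnertonDyer.Theorems.PrintCf2.TwoVarSpecializationFinite.pseudoNull_finite_of_noPseudoNull
    3 ((W.baseChange K).XGr₂ 3 κ₁ κ₂ 𝔭' γ₁ γ₂) ((hasNoPseudoNullSubmodule_iff _).1 hPN)

end Summit.BirchSwinnertonDyer.BirchSwinnertonDyer.Theorems.UniversalToricDescentThinComb.NoPseudoNullOfPoitouTate

end
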